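import Literature.Probability.RandomPlanarGeometry.HexSAWHexagonSurgery
import Literature.Probability.RandomPlanarGeometry.SAWBrickWallHex
import HarnessLib

/-!
# Heights round a hexagon: the vertex freed by a hexagon deletion has the height of a run vertex

Topic `Literature/Probability/RandomPlanarGeometry` (self-avoiding walks on the hexagonal lattice `ℍ` in the
coordinate model `hvGraph` on `HV = ℤ × ℤ × Bool`; add-on to the hexagon surgery `HexSAWHexagonSurgery.lean`).
Lane «pcv-sawmu», doors R76 «HEX-BRIDGE-RATIO-2» / R79 «HEX-HALFSPACE-RATIO-2»: the surgery restricted to bridges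
and half-space walks in the brick-wall frame of `SAWBrickWallHex.lean` (height of `v : HV` = `hvToBW v 0 = v.1 − v.2.1`).

Every edge of `ℍ` changes the brick-wall height by at most one, and round a hexagon the heights read
`x+1, x, x−1, x−1, x, x+1`: EVERY height value is taken twice. Hence — the one geometric input the bridge /
half-space versions of Kesten's argument need (M–S §7.3, proof of Theorem 7.3.4(d): «changing an occurrence of `V`
into an occurrence of `U`» inside bridges) — if five consecutive vertices of a 6-cycle of `ℍ` lie in a height band,
so does the sixth: the vertex `v` put in by `hexDel m v ω` has the height of one of `ω_m, …, ω_{m+4}`, so a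
deletion never leaves a height-defined class of walks.

* `abs_hvToBW_zero_sub_le_one_of_adj` — `|h(v) − h(u)| ≤ 1` along an edge;
* `hvToBW_zero_mem_of_hexagon` — for pairwise distinct `p₀ ~ p₁ ~ ⋯ ~ p₅ ~ p₀`, `h(p₅) ∈ {h(p₀), …, h(p₄)}`
  (transport `p₀` to the origin by `HV.toOrigin`, then one `decide` over the `3⁵` neighbour chains);
* **`exists_hvToBW_zero_eq_of_mem_hexSharp`** — `(m, v) ∈ hexSharp ω`, `ω ∈ S_N(ℍ)` ⇒
  `∃ j ∈ [m, m+4], h(ω_j) = h(v)`; `hvToBW_zero_mem_of_mem_hexSharp` (band form).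
-/

noncomputable section

open Finset
open Literature.Probability.LatticeModels Literature.Probability.Percolation SimpleGraph

namespace Literature.Probability.RandomPlanarGeometry.SAW.HV

/-! ### The brick-wall height along an edge and under `toOrigin` -/

/-- An edge of `ℍ` changes the brick-wall height `hvToBW · 0` by at most one. [folklore] -/
private theorem abs_height_sub_le_one_of_adj {u v : HV} (h : hvGraph.Adj u v) :
    |(v.1 - v.2.1) - (u.1 - u.2.1)| ≤ 1 := by
  obtain ⟨a, b, c⟩ := u
  obtain ⟨a', b', c'⟩ := v
  rw [hvGraph_adj, AdjRel] at h
  rw [abs_le]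
  rcases h with ⟨-, -, h⟩ | ⟨-, -, h⟩ <;> rcases h with ⟨h1, h2⟩ | ⟨h1, h2⟩ | ⟨h1, h2⟩ <;>
    simp only at h1 h2 ⊢ <;> omega

/-- **An edge of `ℍ` changes the brick-wall height by at most one** (`h(v) = hvToBW v 0`; horizontal brick-wall
bonds change it by `±1`, vertical ones keep it). [cite: MadrasSlade1993, Definition 1.2.4 (bridges: heights along a walk)] -/
theorem abs_hvToBW_zero_sub_le_one_of_adj {u v : HV} (h : hvGraph.Adj u v) : |hvToBW v 0 - hvToBW u 0| ≤ 1 := by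
  rw [hvToBW_apply_zero, hvToBW_apply_zero]
  exact abs_height_sub_le_one_of_adj h

/-- Heights under the automorphism `toOrigin u`: equality of heights is preserved. [folklore] -/
private theorem height_toOrigin_eq_iff (u p q : HV) :
    (toOrigin u p).1 - (toOrigin u p).2.1 = (toOrigin u q).1 - (toOrigin u q).2.1 ↔ p.1 - p.2.1 = q.1 - q.2.1 := by
  obtain ⟨a, b, c⟩ := u
  obtain ⟨p1, p2, p3⟩ := p
  obtain ⟨q1, q2, q3⟩ := q
  cases c <;> simp [toOrigin] <;> omega

/-! ### The finite check at the origin -/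

set_option maxRecDepth 100000 in
/-- The check at the origin, by `decide` over the `3⁵ = 243` neighbour chains `[O, p₁, …, p₅]`: if the chain
closes up (`p₅ ~ O`) without repeated vertices, the height of `p₅` occurs among the heights of `O, p₁, …, p₄`.
[folklore] -/
private theorem origin_check :
    ∀ l ∈ ((nbrs hvOrigin).flatMap fun p₁ => (nbrs p₁).flatMap fun p₂ => (nbrs p₂).flatMap fun p₃ =>
        (nbrs p₃).flatMap fun p₄ => (nbrs p₄).map fun p₅ => [hvOrigin, p₁, p₂, p₃, p₄, p₅]),
      (!(decide (l.Nodup) && decide (hvGraph.Adj (l.getD 5 hvOrigin) (l.getD 0 hvOrigin))) ||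
        decide ((l.getD 5 hvOrigin).1 - (l.getD 5 hvOrigin).2.1 ∈
          ((l.take 5).map fun q : HV => q.1 - q.2.1))) = true := by
  decide

/-- Reading the Boolean check as a statement about six explicit vertices with `p₀ = O`. [folklore] -/
private theorem of_origin_check {b c d e f : HV} (h1 : b ∈ nbrs hvOrigin) (h2 : c ∈ nbrs b) (h3 : d ∈ nbrs c)
    (h4 : e ∈ nbrs d) (h5 : f ∈ nbrs e) (hnd : [hvOrigin, b, c, d, e, f].Nodup) (hadj : hvGraph.Adj f hvOrigin) :
    f.1 - f.2.1 = hvOrigin.1 - hvOrigin.2.1 ∨ f.1 - f.2.1 = b.1 - b.2.1 ∨ f.1 - f.2.1 = c.1 - c.2.1 ∨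
      f.1 - f.2.1 = d.1 - d.2.1 ∨ f.1 - f.2.1 = e.1 - e.2.1 := by
  have hmem : [hvOrigin, b, c, d, e, f] ∈
      ((nbrs hvOrigin).flatMap fun p₁ => (nbrs p₁).flatMap fun p₂ => (nbrs p₂).flatMap fun p₃ =>
        (nbrs p₃).flatMap fun p₄ => (nbrs p₄).map fun p₅ => [hvOrigin, p₁, p₂, p₃, p₄, p₅]) := by
    simp only [List.mem_flatMap, List.mem_map]
    exact ⟨b, h1, c, h2, d, h3, e, h4, f, h5, rfl⟩
  have h := origin_check _ hmem
  have h' : f.1 - f.2.1 ∈ [hvOrigin.1 - hvOrigin.2.1, b.1 - b.2.1, c.1 - c.2.1, d.1 - d.2.1, e.1 - e.2.1] := by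
    simpa [List.getD_cons_succ, List.getD_cons_zero, hnd, hadj] using h
  simpa [List.mem_cons] using h'

/-! ### Heights round a hexagon -/

/-- **Every height value round a hexagon is taken twice**: for pairwise distinct `p₀ ~ p₁ ~ ⋯ ~ p₅ ~ p₀` in `ℍ`,
`h(p₅) ∈ {h(p₀), …, h(p₄)}` with `h = hvToBW · 0` (the six vertices form a hexagon, round which the heights read
`x+1, x, x−1, x−1, x, x+1`). Proof: move `p₀` to the origin by `HV.toOrigin` and check the `3⁵` neighbour chains.
[cite: MadrasSlade1993, §7.3 (proof of Theorem 7.3.4(d): the pattern surgery inside bridges)] -/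
theorem hvToBW_zero_mem_of_hexagon {p₀ p₁ p₂ p₃ p₄ p₅ : HV} (h01 : hvGraph.Adj p₀ p₁) (h12 : hvGraph.Adj p₁ p₂)
    (h23 : hvGraph.Adj p₂ p₃) (h34 : hvGraph.Adj p₃ p₄) (h45 : hvGraph.Adj p₄ p₅) (h50 : hvGraph.Adj p₅ p₀)
    (hnd : [p₀, p₁, p₂, p₃, p₄, p₅].Nodup) :
    hvToBW p₅ 0 = hvToBW p₀ 0 ∨ hvToBW p₅ 0 = hvToBW p₁ 0 ∨ hvToBW p₅ 0 = hvToBW p₂ 0 ∨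
      hvToBW p₅ 0 = hvToBW p₃ 0 ∨ hvToBW p₅ 0 = hvToBW p₄ 0 := by
  simp only [hvToBW_apply_zero]
  -- transport to the origin
  set φ := toOrigin p₀ with hφ
  have hq0 : φ p₀ = hvOrigin := toOrigin_apply_self p₀
  have hadj : ∀ {u v : HV}, hvGraph.Adj u v → φ v ∈ nbrs (φ u) := fun h =>
    (hvGraph_adj_iff_mem_nbrs _ _).1 (φ.map_adj_iff.2 h)
  have hnd' : [φ p₀, φ p₁, φ p₂, φ p₃, φ p₄, φ p₅].Nodup := by
    have e : [φ p₀, φ p₁, φ p₂, φ p₃, φ p₄, φ p₅] = [p₀, p₁, p₂, p₃, p₄, p₅].map φ := rfl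
    rw [e]
    exact hnd.map φ.injective
  have h50' : hvGraph.Adj (φ p₅) (φ p₀) := φ.map_adj_iff.2 h50
  have hb := hadj h01
  rw [hq0] at hnd' h50' hb
  have h := of_origin_check hb (hadj h12) (hadj h23) (hadj h34) (hadj h45) hnd' h50'
  rw [← hq0] at h
  simp only [hφ, height_toOrigin_eq_iff] at h
  exact h

/-! ### The vertex freed by a hexagon deletion has the height of a run vertex -/

/-- **The freed vertex of a deletion site has the height of one of the five run vertices**: for
`ω ∈ S_N(ℍ)` and `(m, v) ∈ hexSharp ω` (so `ω_m ~ v ~ ω_{m+4}`, `v ∉ ω`, and `ω_m, …, ω_{m+4}, v` is a hexagon),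
`h(v) = h(ω_j)` for some `j ∈ [m, m+4]` (`h = hvToBW · 0`). Consequently `hexDel m v ω` stays inside any class
of walks defined by a condition on the heights of the vertices (bridges, half-space walks in the brick-wall frame).
[cite: MadrasSlade1993, §7.3 (proof of Theorem 7.3.4(d): the pattern surgery inside bridges)] -/
theorem exists_hvToBW_zero_eq_of_mem_hexSharp {N : ℕ} {ω : List HV} {m : ℕ} {v : HV}
    (hω : ω ∈ sawFin hvOrigin N) (hm : (m, v) ∈ hexSharp ω) :
    ∃ j, m ≤ j ∧ j ≤ m + 4 ∧ hvToBW (ω.getD j hvOrigin) 0 = hvToBW v 0 := by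
  obtain ⟨hml, h1, h2, hv⟩ := mem_hexSharp.1 hm
  have hl := length_of_mem_sawFin hω
  have hadj : ∀ i, i + 1 ≤ m + 4 → m ≤ i → hvGraph.Adj (ω.getD i hvOrigin) (ω.getD (i + 1) hvOrigin) :=
    fun i hi _ => adj_getD_of_mem_sawFin hω (by omega)
  -- the six vertices `ω_m, …, ω_{m+4}, v` are pairwise distinct
  have hne : ∀ i j, m ≤ i → i < j → j ≤ m + 4 → ω.getD i hvOrigin ≠ ω.getD j hvOrigin := by
    intro i j hi hij hj e
    have := getD_injOn_of_mem_sawFin hω (by omega) (by omega) e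
    omega
  have hvne : ∀ i, i ≤ m + 4 → ω.getD i hvOrigin ≠ v := by
    intro i hi e
    apply hv
    rw [← e, ← List.getElem_eq_getD (h := by omega)]
    exact List.getElem_mem (by omega)
  have hnd : [ω.getD m hvOrigin, ω.getD (m + 1) hvOrigin, ω.getD (m + 2) hvOrigin, ω.getD (m + 3) hvOrigin,
      ω.getD (m + 4) hvOrigin, v].Nodup := by
    simp only [List.nodup_cons, List.mem_cons, List.not_mem_nil, or_false, not_or, List.nodup_nil, and_true,
      not_false_eq_true]
    refine ⟨⟨hne _ _ le_rfl (by omega) (by omega), hne _ _ le_rfl (by omega) (by omega),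
      hne _ _ le_rfl (by omega) (by omega), hne _ _ le_rfl (by omega) (by omega), hvne _ (by omega)⟩,
      ⟨hne _ _ (by omega) (by omega) (by omega), hne _ _ (by omega) (by omega) (by omega),
      hne _ _ (by omega) (by omega) (by omega), hvne _ (by omega)⟩,
      ⟨hne _ _ (by omega) (by omega) (by omega), hne _ _ (by omega) (by omega) (by omega), hvne _ (by omega)⟩,
      ⟨hne _ _ (by omega) (by omega) (by omega), hvne _ (by omega)⟩, hvne _ (by omega)⟩
  have h := hvToBW_zero_mem_of_hexagon (hadj m (by omega) le_rfl)
    (by have := hadj (m + 1) (by omega) (by omega); exact this)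
    (by have := hadj (m + 2) (by omega) (by omega); exact this)
    (by have := hadj (m + 3) (by omega) (by omega); exact this) h2.symm h1.symm hnd
  rcases h with h | h | h | h | h
  · exact ⟨m, le_rfl, by omega, h.symm⟩
  · exact ⟨m + 1, by omega, by omega, h.symm⟩
  · exact ⟨m + 2, by omega, by omega, h.symm⟩
  · exact ⟨m + 3, by omega, by omega, h.symm⟩
  · exact ⟨m + 4, by omega, le_rfl, h.symm⟩

/-- **Deletion keeps a height band**: if `ω_m, …, ω_{m+4}` have heights in a set `S`, so does the freed vertex `v` of
a deletion site `(m, v)`. [cite: MadrasSlade1993, §7.3 (proof of Theorem 7.3.4(d))] -/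
theorem hvToBW_zero_mem_of_mem_hexSharp {N : ℕ} {ω : List HV} {m : ℕ} {v : HV} {S : Set ℤ}
    (hω : ω ∈ sawFin hvOrigin N) (hm : (m, v) ∈ hexSharp ω)
    (hS : ∀ j, m ≤ j → j ≤ m + 4 → hvToBW (ω.getD j hvOrigin) 0 ∈ S) : hvToBW v 0 ∈ S := by
  obtain ⟨j, hj1, hj2, hj⟩ := exists_hvToBW_zero_eq_of_mem_hexSharp hω hm
  exact hj ▸ hS j hj1 hj2

end Literature.Probability.RandomPlanarGeometry.SAW.HV
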